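import Summits.ABC.IUTFork.LDHCor312Primes
import HarnessLib

/-!
# The fork at [IUTchIII] Corollary 3.12, L-DH level: the SUPPORT of `hull(U_Θ)` ([IUTchIV] Thm. 1.10 Step (vi))
# from three summand-level facts

Record-only file (D-0012) of the abc-iut cell (campaign-S seat abc-iut-S2, gen 2; `plan/D9PRIME-OBLIGATIONS.md`
row O3); TAKES NO SIDE. abc-iut-c312-3's `DHData.HullSupportedOn T₀` (`LDHCor312Primes.lean`: "off `T₀`
every component of `hull(U_Θ)` has `log μ̄ = 0` — the content of [IUTchIV] Prop. 1.4 (iv) / Thm. 1.10 Step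
(vi) off `V^dst`; an obligation of the concrete model") is what makes the finite prime sums of the L-DH files
stabilise to Dupuy–Hilado's `Σ_p`, and what gives the field `Z ≤ 0` / `hoff` of the cell's local proof data
(`LDHLocalProofData`). Mochizuki, [IUTchIV] proof of Thm. 1.10, Step (vi), p. 29: "the inclusion
“`φ((R_I)^∼) ⊆ (R_I)^∼`” of Proposition 1.4, (iv), implies that the tensor product of log-shells under
consideration contains the “union of possible images of a Θ-pilot object” … the “container of possible
images” is precisely equal to the tensor product of log-shells … Such an upper bound “`0`”".

THIS FILE proves `HullSupportedOn T₀` for ANY Dupuy–Hilado datum `D` (over c312-3's interface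
`IndPacketModel`, `MultiradialRegion.lean`) from the three SUMMAND-LEVEL facts the text uses, stated as
hypotheses at the primes `p ∉ T₀` (with `T₀ ⊇` the residue characteristics of `S`):
* `hshell` — the log-shell lattice IS the integral structure there, `I_{v⃗} = O_{v⃗}` (for the real packet at
  an odd prime with all `e_i = 1`: `log_p(O_i^×) = p·O_i`, so `(2p)^{−|I|}·⊗ log_p(O_i^×) = (R_I)^∼`; [IUTchIV]
  Prop. 1.2 (iv) / 1.4 (iv));
* `hhull` — the integral structure is hull-closed, `hull(O_{v⃗}) = O_{v⃗}` (real packet: abc-iut-S2's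
  `TensorPacketHull.packetHull_normalizedPacket`);
* `hbare` — the (Ind3)-region stays integral there, `(O_𝕃(−P_Θ))^{Ind3}_{v⃗} ⊆ O_{v⃗}` (Dupuy–Hilado (4.10) with
  `t_{Θ,j,v}` a unit off `S` gives this in the degrees `1 ≤ j ≤ l⋇` once `I_{v⃗} = O_{v⃗}`; in the other
  degrees it is a condition on the datum).
Then (`logμ_hullUTheta_eq_zero_of_shell`, `hullSupportedOn_of_shell`): every (Ind1)-transport of an
integral region is integral (`perm_shell` + `hshell`), every (Ind2)-image of `O` is `O` (`smul_shell` +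
`hshell`), so `U_Θ ∩ X_{v⃗} ⊆ O_{v⃗}`, `hull(U_Θ)_{v⃗} ⊆ hull(O_{v⃗}) = O_{v⃗}`, while `hull(U_Θ)_{v⃗} ⊇
O_𝕃(−P_Θ)_{v⃗}` whose `log μ̄` is `0` off `S` (Thm. 3.10.1; the theta-idele is a unit there) — squeeze:
`log μ̄(hull(U_Θ)_{v⃗}) = 0`. Corollaries: the stabilised/`Σ_p` forms of (1.1) (`cor312DHLim_iff_of_hullSupportedOn`)
and the Step (vi) input `hoff` of `localProofDataAvgOfDH` (`logμ_hullUTheta_nonpos_of_shell`).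
[cite: Mochizuki2012, IUTchIV Thm 1.10 proof Step (vi) p.29] [cite: DupuyHilado2025, §4.7, §4.9–4.12]
Deliberately NOT here: the three facts for the real tensor-packet model (abc-iut-c312-3's `tensorPacketModel`,
files p409052/p409064/p409077 pending: `realPrimePacket_shell/_hullLoc/_O`); any judgement on Cor. 3.12.
-/

noncomputable section

open Set Finset

namespace Summit.ABC.IUTFork

open Literature.IUT.LogVolume NumberField IsDedekindDomain
open scoped Pointwise

variable {F : Type} [Field F] [NumberField F]

namespace DHData

variable (D : DHData F)

/-- A place over a prime `p ∉ T₀ ⊇ char(S)` is not in `S`. [folklore] -/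
private theorem not_mem_S_of_not_mem_T₀ {T₀ : Finset ℕ} (hST : ∀ v ∈ D.X.S, residueChar F v ∈ T₀)
    {p : ℕ} (hp : p.Prime) (hpT : p ∉ T₀) (v : placesOver F p) : v.1 ∉ D.X.S := by
  intro hv
  haveI : Fact p.Prime := ⟨hp⟩
  have h := hST v.1 hv
  rw [(mem_placesOver_iff_residueChar v.1).mp v.2] at h
  exact hpT h

/-- Off `S` the components of the bare theta region have `log μ̄ = 0`: in the degrees `1 ≤ j ≤ l⋇` they are
`t_{Θ,j,v_j}·O_{v⃗}` with `ord_v(t_{Θ,j,v_j}) = P_{Θ,j}(v_j) = 0` (Thm. 3.10.1 / (3.7)), elsewhere `O_{v⃗}`.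
[cite: DupuyHilado2025, §3.7, §3.9] -/
theorem logμ_regionΘ_eq_zero {T₀ : Finset ℕ} (hST : ∀ v ∈ D.X.S, residueChar F v ∈ T₀) {p : ℕ}
    (hp : p.Prime) (hpT : p ∉ T₀) (j : ℕ) (e : Fin (j + 1) → placesOver F p) :
    D.M.logμ (D.M.region D.tΘ p j e) = 0 := by
  unfold PacketModel.region
  split_ifs with h
  · rw [D.M.logμ_peel_O, PacketModel.lnAbs, D.tΘ_ord,
      D.thetaPilot_apply_of_not_mem (D.not_mem_S_of_not_mem_T₀ hST hp hpT _)]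
    simp
  · exact D.M.logμ_O p j e

/-- **`U_Θ ∩ X_{v⃗} ⊆ O_{v⃗}` at a prime where the log-shell is the integral structure and the (Ind3)-region is
integral**: every (Ind1)-transport carries `O_{v⃗∘σ}` onto `O_{v⃗}` ("fixes the lattice", `perm_shell`) and every
(Ind2)-element fixes `O_{v⃗}` ("preserve this lattice", `smul_shell`). [cite: DupuyHilado2025, §4.7, §4.9, §4.11] -/
theorem UThetaUnion_subset_O_of_shell {p : ℕ} {j : ℕ}
    (hshell : ∀ e : Fin (j + 1) → placesOver F p, D.M.shell p j e = D.M.O p j e)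
    (hbare : ∀ e : Fin (j + 1) → placesOver F p, D.ind3.bare3 p j e ⊆ D.M.O p j e)
    (e : Fin (j + 1) → placesOver F p) :
    D.M.UThetaUnion D.ind3 p j e ⊆ D.M.O p j e := by
  intro x hx
  obtain ⟨lam, hlam⟩ := Set.mem_iUnion.mp hx
  change x ∈ lam.1 p j e • (D.M.perm (lam.2 j) e '' D.ind3.bare3 p j (e ∘ lam.2 j)) at hlam
  -- the transported (Ind3)-region is integral
  have h1 : D.M.perm (lam.2 j) e '' D.ind3.bare3 p j (e ∘ lam.2 j) ⊆ D.M.O p j e := by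
    refine (Set.image_mono (hbare (e ∘ lam.2 j))).trans ?_
    rw [← hshell (e ∘ lam.2 j), D.M.perm_shell (lam.2 j) e, hshell e]
  -- and the (Ind2)-element fixes `O`
  have h2 : lam.1 p j e • D.M.O p j e = D.M.O p j e := by
    rw [← hshell e, D.M.smul_shell (lam.1 p j e)]
  rw [← h2]
  exact Set.smul_set_mono h1 hlam

/-- … hence `hull(U_Θ)_{v⃗} ⊆ O_{v⃗}` when `O_{v⃗}` is hull-closed. [cite: DupuyHilado2025, §4.12] -/
theorem hullUTheta_subset_O_of_shell {p : ℕ} {j : ℕ}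
    (hshell : ∀ e : Fin (j + 1) → placesOver F p, D.M.shell p j e = D.M.O p j e)
    (hhull : ∀ e : Fin (j + 1) → placesOver F p, D.M.hullLoc p j e (D.M.O p j e) = D.M.O p j e)
    (hbare : ∀ e : Fin (j + 1) → placesOver F p, D.ind3.bare3 p j e ⊆ D.M.O p j e)
    (e : Fin (j + 1) → placesOver F p) :
    D.M.hullUTheta D.ind3 p j e ⊆ D.M.O p j e := by
  have h := (D.M.hullLoc p j e).monotone (D.UThetaUnion_subset_O_of_shell hshell hbare e)
  rw [hhull e] at h
  exact h

/-- **Step (vi) at one summand**: at a prime `p ∉ T₀ ⊇ char(S)` where the log-shell is the (hull-closed)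
integral structure and the (Ind3)-region is integral, `log μ̄(hull(U_Θ)_{v⃗}) = 0` — squeezed between
`O_𝕃(−P_Θ)_{v⃗}` (log-measure `0` off `S`) and `O_{v⃗}` (log-measure `0`). "Such an upper bound “`0`” is given in
the final equality of Proposition 1.4, (iv)." [cite: Mochizuki2012, IUTchIV Thm 1.10 proof Step (vi) p.29] -/
theorem logμ_hullUTheta_eq_zero_of_shell {T₀ : Finset ℕ} (hST : ∀ v ∈ D.X.S, residueChar F v ∈ T₀) {p : ℕ}
    (hp : p.Prime) (hpT : p ∉ T₀) {j : ℕ}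
    (hshell : ∀ e : Fin (j + 1) → placesOver F p, D.M.shell p j e = D.M.O p j e)
    (hhull : ∀ e : Fin (j + 1) → placesOver F p, D.M.hullLoc p j e (D.M.O p j e) = D.M.O p j e)
    (hbare : ∀ e : Fin (j + 1) → placesOver F p, D.ind3.bare3 p j e ⊆ D.M.O p j e)
    (e : Fin (j + 1) → placesOver F p) :
    D.M.logμ (D.M.hullUTheta D.ind3 p j e) = 0 := by
  have hadm : D.M.adm (D.M.hullUTheta D.ind3 p j e) := D.hull_adm p j e
  -- upper bound: `hull(U_Θ) ⊆ O`, `log μ̄(O) = 0`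
  have hup : D.M.logμ (D.M.hullUTheta D.ind3 p j e) ≤ 0 := by
    rw [← D.M.logμ_O p j e]
    exact D.M.logμ_mono hadm (D.M.O_adm p j e) (D.hullUTheta_subset_O_of_shell hshell hhull hbare e)
  -- lower bound: `O_𝕃(−P_Θ) ⊆ hull(U_Θ)`, `log μ̄(O_𝕃(−P_Θ)_{v⃗}) = 0` off `S`
  have hlow : 0 ≤ D.M.logμ (D.M.hullUTheta D.ind3 p j e) := by
    rw [← D.logμ_regionΘ_eq_zero hST hp hpT j e]
    exact D.M.logμ_mono (D.M.region_adm D.tΘ p j e) hadm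
      ((D.M.region_subset_UTheta_one D.ind3 p j e).trans (D.M.UTheta_le_hullUTheta D.ind3 _ p j e))
  exact le_antisymm hup hlow

/-- **`HullSupportedOn T₀` from the three summand-level facts** off `T₀` (with `T₀ ⊇ char(S)`): the
log-shell is the integral structure, the integral structure is hull-closed, the (Ind3)-region is integral.
[cite: Mochizuki2012, IUTchIV Thm 1.10 proof Step (vi) p.29] -/
theorem hullSupportedOn_of_shell (T₀ : Finset ℕ) (hST : ∀ v ∈ D.X.S, residueChar F v ∈ T₀)
    (hshell : ∀ p, p.Prime → p ∉ T₀ → ∀ (j : ℕ) (e : Fin (j + 1) → placesOver F p),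
      D.M.shell p j e = D.M.O p j e)
    (hhull : ∀ p, p.Prime → p ∉ T₀ → ∀ (j : ℕ) (e : Fin (j + 1) → placesOver F p),
      D.M.hullLoc p j e (D.M.O p j e) = D.M.O p j e)
    (hbare : ∀ p, p.Prime → p ∉ T₀ → ∀ (j : ℕ) (e : Fin (j + 1) → placesOver F p),
      D.ind3.bare3 p j e ⊆ D.M.O p j e) :
    D.HullSupportedOn T₀ :=
  fun p hp hpT j e => D.logμ_hullUTheta_eq_zero_of_shell hST hp hpT (hshell p hp hpT j)
    (hhull p hp hpT j) (hbare p hp hpT j) e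

/-- **The Step (vi) input `hoff` of the local proof data** (`LDHLocalProofData.localProofDataAvgOfDH`,
`LDHEstimateAssembly.negLogThetaDH_le_sum_dst`): under the same three facts off a set `dst` of primes
containing `char(S)`, every component of `hull(U_Θ)` off `dst` has `log μ̄ ≤ 0`.
[cite: Mochizuki2012, IUTchIV Thm 1.10 proof Step (vi) p.29] -/
theorem logμ_hullUTheta_nonpos_of_shell (dst : Finset ℕ) (hST : ∀ v ∈ D.X.S, residueChar F v ∈ dst)
    (hshell : ∀ p, p.Prime → p ∉ dst → ∀ (j : ℕ) (e : Fin (j + 1) → placesOver F p),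
      D.M.shell p j e = D.M.O p j e)
    (hhull : ∀ p, p.Prime → p ∉ dst → ∀ (j : ℕ) (e : Fin (j + 1) → placesOver F p),
      D.M.hullLoc p j e (D.M.O p j e) = D.M.O p j e)
    (hbare : ∀ p, p.Prime → p ∉ dst → ∀ (j : ℕ) (e : Fin (j + 1) → placesOver F p),
      D.ind3.bare3 p j e ⊆ D.M.O p j e) :
    ∀ p ∈ D.T, p ∉ dst → ∀ j, 1 ≤ j → j ≤ D.X.lstar → ∀ e : Fin (j + 1) → placesOver F p,
      D.M.logμ (D.M.hullUTheta D.ind3 p j e) ≤ 0 :=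
  fun p hp hpd j _ _ e => (D.logμ_hullUTheta_eq_zero_of_shell hST (D.T_prime p hp) hpd
    (hshell p (D.T_prime p hp) hpd j) (hhull p (D.T_prime p hp) hpd j) (hbare p (D.T_prime p hp) hpd j) e).le

/-- Under the three facts off `T₀ ⊇ T`, (1.1) with `Σ_p` (`Cor312DHLim`) is EQUIVALENT to its truncation to
`T₀` (c312-3's `cor312DHLim_iff_of_hullSupportedOn`). [claim: Mochizuki2012, status: disputed] -/
theorem cor312DHLim_iff_of_shell (T₀ : Finset ℕ) (hT : D.T ⊆ T₀) (hT₀ : ∀ p ∈ T₀, p.Prime)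
    (hshell : ∀ p, p.Prime → p ∉ T₀ → ∀ (j : ℕ) (e : Fin (j + 1) → placesOver F p),
      D.M.shell p j e = D.M.O p j e)
    (hhull : ∀ p, p.Prime → p ∉ T₀ → ∀ (j : ℕ) (e : Fin (j + 1) → placesOver F p),
      D.M.hullLoc p j e (D.M.O p j e) = D.M.O p j e)
    (hbare : ∀ p, p.Prime → p ∉ T₀ → ∀ (j : ℕ) (e : Fin (j + 1) → placesOver F p),
      D.ind3.bare3 p j e ⊆ D.M.O p j e) :
    D.Cor312DHLim ↔ D.Cor312DHOn T₀ :=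
  D.cor312DHLim_iff_of_hullSupportedOn
    (D.hullSupportedOn_of_shell T₀ (fun v hv => hT (D.S_sub v hv)) hshell hhull hbare) hT hT₀

end DHData

end Summit.ABC.IUTFork

end
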